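import Summits.NavierStokesRegularity.NavierStokesRegularity.Theorems.EulerZoomLiouvillePowerGaugeEulerLiouvilleWeakBernoulliBands

/-!
# «NO BERNOULLI PLATEAUS OFF THE SIMILARITY-STAGNATION SET» and the member level of «BERNOULLI BANDS ARE KINETICALLY THIN»
# (crux `EulerZoomLiouville.PowerGaugeEulerLiouville` = stmt-NavierStokesRegularity-19832, line `birth`, open stub `stub_selfSimilarWeakRest`)

Width seat `ns-ezl-w1` (g7) under the crux LEAD.  Sequel of `…WeakBernoulliBands` (`setIntegral_band_norm_transport_sq_le`:
`∫_{B_L ∩ {|ℋ−m| ≤ δ}} ‖W‖² ≤ C δ L³` for a weak class profile, `0 ≤ γ < ½`).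

* **`WeakRenormalized.volume_level_inter_eq_zero`** — «NO BERNOULLI PLATEAUS»: for every level `m`,
  `vol({ℋ = m} ∩ {W ≠ 0}) = 0`.  The level set `{ℋ = m}` lies in every band `{|ℋ − m| ≤ δ}`, so on `B_L ∩ {‖W‖ ≥ w}` its volume is
  `≤ C δ L³ / w²` for every `δ > 0`, hence zero; exhaust `{W ≠ 0}` by `w = 1/(k+1)`, `L = max L₀ 1 + k`.  Reading: the Bernoulli
  function of a weak class profile is merely `W^{1,1}_loc`, so a priori it could be constant on a set of positive measure; it cannot,
  except on hovering fluid (`W = 0`): in the genuinely weak stratum too, the only flat part of the Bernoulli landscape is the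
  similarity-stagnation set — the hovering face of the `C²` portrait (RESIDUE-MEMO-19832 §5/§7);
* member level **`…setIntegral_band_norm_transport_sq_le_of_selfSimilar`**, **`…volume_level_inter_eq_zero_of_selfSimilar`** (and `_of_past`):
  crux hypotheses verbatim, `0 < ρ ≤ ½` (`γ = 1/(2+ρ) ∈ [2/5, ½)`), exact self-similarity ⇒ both statements for the member's profile, NO
  regularity.

WHAT THIS IS NOT: not NS, not E, not the stub — weak-class PORTRAIT TOOLS (`--supports` stmt-19832); no summit statement is proved here;
19832 OPEN. [folklore; cf. ConstantinIgnatovaVicol2026Putative §3.4.3 (3.31)]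
-/

noncomputable section

set_option linter.dupNamespace false
-- nested operator types (`innerSL … ∘L …`)
set_option maxSynthPendingDepth 3

open MeasureTheory Set Filter Topology Metric Function TopologicalSpace
open scoped ENNReal NNReal RealInnerProductSpace ContDiff

namespace Summit.NavierStokesRegularity.NavierStokesRegularity.Theorems.PowerGaugeEulerLiouville

open Literature.Analysis Literature.Analysis.FunctionSpaces Literature.Analysis.FluidPDE

namespace WeakRenormalized

variable {V : EuclideanSpace ℝ (Fin 3) → EuclideanSpace ℝ (Fin 3)} {P : EuclideanSpace ℝ (Fin 3) → ℝ}
  {G : EuclideanSpace ℝ (Fin 3) → EuclideanSpace ℝ (Fin 3) →L[ℝ] EuclideanSpace ℝ (Fin 3)}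

/-! ## No Bernoulli plateaus off the stagnation set -/

section Plateau

/-- `a ≤ D·δ` for every `δ > 0` (`D ≥ 0`) forces `a ≤ 0`. [folklore] -/
theorem nonpos_of_forall_le_mul {a D : ℝ} (hD : 0 ≤ D) (h : ∀ δ : ℝ, 0 < δ → a ≤ D * δ) : a ≤ 0 := by
  by_contra ha
  rw [not_le] at ha
  have hδ : 0 < a / (2 * (D + 1)) := by positivity
  have h1 := h _ hδ
  have h2 : D * (a / (2 * (D + 1))) ≤ a / 2 := by
    rw [mul_div_assoc', div_le_div_iff₀ (by positivity) (by norm_num)]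
    nlinarith
  linarith

/-- **«NO BERNOULLI PLATEAUS OFF THE SIMILARITY-STAGNATION SET» (weak class, `0 ≤ γ < ½`).**  Under the hypotheses of
`setIntegral_band_norm_transport_sq_le` (weak class profile with the Lamb form and the `A`-growth `∫_{B_L}‖V‖² ≤ c_A L³`, `L ≥ L₀`), for
every level `m`:

  `vol({ℋ = m} ∩ {W ≠ 0}) = 0`,   `ℋ = selfSimilarBernoulli γ 0 V P`, `W = selfSimilarTransport γ 0 V`.

The level sets of the (merely `W^{1,1}_loc`) Bernoulli function of a weak class profile are Lebesgue-null away from hovering fluid.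
Proof: `{ℋ = m} ⊆ {|ℋ − m| ≤ δ}` for every `δ > 0`, so `w²·vol({ℋ = m} ∩ {‖W‖ ≥ w} ∩ B_L) ≤ ∫_{B_L∩{|ℋ−m|≤δ}}‖W‖² ≤ CδL³ → 0`;
exhaust `{W ≠ 0}` by `w = 1/(k+1)`, `L = max L₀ 1 + k`. [folklore; cf. ConstantinIgnatovaVicol2026Putative §3.4.3 (3.31)] -/
theorem volume_level_inter_eq_zero {γ : ℝ} (hγ0 : 0 ≤ γ) (hγ : γ < 1 / 2)
    (hV6 : ∀ r : ℝ, MemLp V 6 (volume.restrict (ball (0 : EuclideanSpace ℝ (Fin 3)) r)))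
    (hG2 : ∀ r : ℝ, MemLp G 2 (volume.restrict (ball (0 : EuclideanSpace ℝ (Fin 3)) r)))
    (hP32 : ∀ r : ℝ, MemLp P (3 / 2 : ℝ≥0∞) (volume.restrict (ball (0 : EuclideanSpace ℝ (Fin 3)) r)))
    (hdiv : IsWeaklyDivFree V)
    (hH : HasWeakFDerivOn (⊤ : Opens (EuclideanSpace ℝ (Fin 3))) volume (selfSimilarBernoulli γ 0 V P)
      (fun x => (2 * γ - 1) • innerSL ℝ (selfSimilarTransport γ 0 V x) +
        (innerSL ℝ (selfSimilarTransport γ 0 V x)).comp (G x) - innerSL ℝ (G x (selfSimilarTransport γ 0 V x))))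
    {cA L₀ : ℝ} (hcA : 0 ≤ cA)
    (hA : ∀ L : ℝ, L₀ ≤ L → ∫ x in ball (0 : EuclideanSpace ℝ (Fin 3)) L, ‖V x‖ ^ 2 ≤ cA * L ^ 3) (m : ℝ) :
    volume ({x | selfSimilarBernoulli γ 0 V P x = m} ∩ {x | selfSimilarTransport γ 0 V x ≠ 0}) = 0 := by
  obtain ⟨C, hC0, hC⟩ := setIntegral_band_norm_transport_sq_le hγ0 hγ hV6 hG2 hP32 hdiv hH hcA hA
  set Hb : EuclideanSpace ℝ (Fin 3) → ℝ := selfSimilarBernoulli γ 0 V P with hHb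
  set W : EuclideanSpace ℝ (Fin 3) → EuclideanSpace ℝ (Fin 3) := selfSimilarTransport γ 0 V with hWdef
  set L₁ : ℝ := max L₀ 1 with hL₁
  have hL₁1 : 1 ≤ L₁ := le_max_right _ _
  -- measurability
  have hHl : LocallyIntegrable Hb volume := locallyIntegrableOn_univ.1 (by
    simpa only [Opens.coe_top] using hH.locallyIntegrableOn)
  have hHm : AEStronglyMeasurable Hb volume := hHl.aestronglyMeasurable
  have hVl : LocallyIntegrable V volume := WeakBernoulli.locallyIntegrable_of_memLp_six_ball hV6
  have hWm : AEStronglyMeasurable W volume := (locallyIntegrable_transport (γ := γ) hVl).aestronglyMeasurable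
  -- the exhausting pieces
  set T : ℕ → Set (EuclideanSpace ℝ (Fin 3)) := fun k =>
    ({x | Hb x = m} ∩ {x | (1 : ℝ) / ((k : ℝ) + 1) ≤ ‖W x‖}) ∩ ball (0 : EuclideanSpace ℝ (Fin 3)) (L₁ + k) with hT
  have hcover : {x | Hb x = m} ∩ {x | W x ≠ 0} ⊆ ⋃ k, T k := by
    intro x hx
    obtain ⟨hxm, hxW⟩ := hx
    have hWpos : 0 < ‖W x‖ := norm_pos_iff.2 hxW
    obtain ⟨k, hk⟩ := exists_nat_ge (1 / ‖W x‖ + ‖x‖)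
    refine mem_iUnion.2 ⟨k, ⟨hxm, ?_⟩, ?_⟩
    · show (1 : ℝ) / ((k : ℝ) + 1) ≤ ‖W x‖
      rw [div_le_iff₀ (by positivity)]
      have h1 : 1 / ‖W x‖ ≤ (k : ℝ) + 1 := by linarith [norm_nonneg x]
      have h2 := (div_le_iff₀ hWpos).1 h1
      linarith
    · rw [mem_ball, dist_zero_right]
      have : 0 ≤ 1 / ‖W x‖ := by positivity
      linarith
  refine measure_mono_null hcover (measure_iUnion_null fun k => ?_)
  -- each piece is null
  set w : ℝ := (1 : ℝ) / ((k : ℝ) + 1) with hw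
  have hw0 : 0 < w := by positivity
  set L : ℝ := L₁ + k with hLdef
  have hL : L₁ ≤ L := by rw [hLdef]; exact le_add_of_nonneg_right (Nat.cast_nonneg k)
  have hL0 : 0 < L := lt_of_lt_of_le one_pos (hL₁1.trans hL)
  have hTsub : T k ⊆ ball (0 : EuclideanSpace ℝ (Fin 3)) L := fun x hx => hx.2
  have hTfin : volume (T k) ≠ ⊤ := ((measure_mono hTsub).trans_lt measure_ball_lt_top).ne
  have hTn : NullMeasurableSet (T k) volume :=
    ((nullMeasurableSet_eq_fun hHm.aemeasurable aemeasurable_const).inter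
      (nullMeasurableSet_le aemeasurable_const hWm.norm.aemeasurable)).inter measurableSet_ball.nullMeasurableSet
  haveI : IsFiniteMeasure ((volume : Measure (EuclideanSpace ℝ (Fin 3))).restrict (ball 0 L)) :=
    isFiniteMeasure_restrict.2 measure_ball_lt_top.ne
  have hW2 : MemLp W 2 (volume.restrict (ball (0 : EuclideanSpace ℝ (Fin 3)) L)) :=
    (memLp_transport_six (γ := γ) (hV6 L)).mono_exponent (by norm_num)
  have hIW2 : IntegrableOn (fun x => ‖W x‖ ^ 2) (ball (0 : EuclideanSpace ℝ (Fin 3)) L) volume :=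
    (memLp_two_iff_integrable_sq_norm hW2.1).1 hW2
  -- `w² vol(T) ≤ ∫_T ‖W‖² ≤ ∫_{B_L ∩ band δ} ‖W‖² ≤ C δ L³`
  have hkey : ∀ δ : ℝ, 0 < δ → volume.real (T k) * w ^ 2 ≤ C * L ^ 3 * δ := by
    intro δ hδ
    have h1 : volume.real (T k) * w ^ 2 ≤ ∫ x in T k, ‖W x‖ ^ 2 := by
      rw [← smul_eq_mul, ← setIntegral_const]
      refine setIntegral_mono_ae_restrict (integrableOn_const (hs := hTfin)) (hIW2.mono_set hTsub) ?_
      filter_upwards [ae_restrict_mem₀ hTn] with x hx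
      have h := hx.1.2
      calc w ^ 2 = w * w := sq w
        _ ≤ ‖W x‖ * ‖W x‖ := mul_le_mul h h hw0.le (norm_nonneg _)
        _ = ‖W x‖ ^ 2 := (sq _).symm
    have h2 : ∫ x in T k, ‖W x‖ ^ 2 ≤ ∫ x in ball (0 : EuclideanSpace ℝ (Fin 3)) L ∩ {x | |Hb x - m| ≤ δ}, ‖W x‖ ^ 2 := by
      refine setIntegral_mono_set (hIW2.mono_set inter_subset_left) (Eventually.of_forall fun x => by positivity)
        (Eventually.of_forall fun x hx => ⟨hx.2, ?_⟩)
      show |Hb x - m| ≤ δ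
      rw [show Hb x = m from hx.1.1, sub_self, abs_zero]; exact hδ.le
    have h3 := hC L hL m δ hδ
    calc volume.real (T k) * w ^ 2 ≤ _ := h1.trans h2
      _ ≤ C * δ * L ^ 3 := h3
      _ = C * L ^ 3 * δ := by ring
  have hreal : volume.real (T k) * w ^ 2 ≤ 0 := nonpos_of_forall_le_mul (by positivity) hkey
  have hreal0 : volume.real (T k) ≤ 0 := by
    by_contra hpos
    rw [not_le] at hpos
    have : 0 < volume.real (T k) * w ^ 2 := by positivity
    linarith
  have hz : volume.real (T k) = 0 := le_antisymm hreal0 measureReal_nonneg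
  exact (measureReal_eq_zero_iff hTfin).1 hz

end Plateau

/-! ## Member level -/

section Member

/-- **«BERNOULLI BANDS ARE KINETICALLY THIN» FOR A PAST-EXACT SELF-SIMILAR CLASS MEMBER** (`0 < ρ ≤ ½`, `γ = 1/(2+ρ)`; NO regularity of
the profile): crux hypotheses verbatim, exact self-similarity about `(T, x₀)` for `τ < T₁` (`T₁ ≤ 0`, `T₁ ≤ T`) ⇒ there are `C ≥ 0` and `L₁`
with `∫_{B_L ∩ {|ℋ−m| ≤ δ}} ‖W‖² ≤ C δ L³` for all `L ≥ L₁`, all `m`, all `δ > 0`. [folklore] -/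
theorem setIntegral_band_norm_transport_sq_le_of_past {ρ : ℝ} (hρ : 0 < ρ) (hρh : ρ ≤ 1 / 2)
    {T T₁ : ℝ} (hT₁ : T₁ ≤ 0) (hTT₁ : T₁ ≤ T) (x₀ : EuclideanSpace ℝ (Fin 3))
    {u : ℝ → EuclideanSpace ℝ (Fin 3) → EuclideanSpace ℝ (Fin 3)} {p : ℝ → EuclideanSpace ℝ (Fin 3) → ℝ}
    {H : ℝ → EuclideanSpace ℝ (Fin 3) → EuclideanSpace ℝ (Fin 3) →L[ℝ] EuclideanSpace ℝ (Fin 3)} {c : ℝ≥0}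
    (hsw : IsSuitableWeakSolutionOn (slab (EuclideanSpace ℝ (Fin 3)) (Iio 0) isOpen_Iio) 0 0 u p)
    (hH : HasWeakSpatialGradientOn (slab (EuclideanSpace ℝ (Fin 3)) (Iio 0) isOpen_Iio) u H)
    (hgauge : ∀ a : ℝ, 0 < a →
      ENNReal.ofReal (a ^ (2 * ρ)) * cknA a (0 : ℝ × EuclideanSpace ℝ (Fin 3)) u +
          ENNReal.ofReal (a ^ ρ) * cknE a (0 : ℝ × EuclideanSpace ℝ (Fin 3)) H +
        ENNReal.ofReal (a ^ (2 * ρ)) * cknD a (0 : ℝ × EuclideanSpace ℝ (Fin 3)) p ≤ (c : ℝ≥0∞))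
    {V : EuclideanSpace ℝ (Fin 3) → EuclideanSpace ℝ (Fin 3)} {P : EuclideanSpace ℝ (Fin 3) → ℝ}
    (hu : ∀ τ : ℝ, τ < T₁ → u τ = fun x => selfSimilarCollapse (1 / (2 + ρ)) T V τ (x - x₀))
    (hp : ∀ τ : ℝ, τ < T₁ → p τ = fun x => selfSimilarCollapsePressure (1 / (2 + ρ)) T P τ (x - x₀)) :
    ∃ C L₁ : ℝ, 0 ≤ C ∧ ∀ L : ℝ, L₁ ≤ L → ∀ m δ : ℝ, 0 < δ →
      ∫ x in ball (0 : EuclideanSpace ℝ (Fin 3)) L ∩ {x | |selfSimilarBernoulli (1 / (2 + ρ)) 0 V P x - m| ≤ δ},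
          ‖selfSimilarTransport (1 / (2 + ρ)) 0 V x‖ ^ 2 ≤ C * δ * L ^ 3 := by
  have hγ0 : 0 ≤ 1 / (2 + ρ) := by positivity
  have hγ : 1 / (2 + ρ) < 1 / 2 := by
    rw [div_lt_div_iff₀ (by linarith) (by norm_num)]; linarith
  obtain ⟨G, hV6, hG2, hP32, hdiv, hHb, cA, hcA, hA⟩ := renormalizationData_of_past hρ hρh hT₁ hTT₁ x₀ hsw hH hgauge hu hp
  obtain ⟨C, hC0, hC⟩ := setIntegral_band_norm_transport_sq_le hγ0 hγ hV6 hG2 hP32 hdiv hHb hcA hA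
  exact ⟨C, max (max (2 - T₁) 1) 1, hC0, hC⟩

/-- **«BERNOULLI BANDS ARE KINETICALLY THIN» FOR AN EXACTLY SELF-SIMILAR CLASS MEMBER (origin-centred; binder shape of the skeleton's
`IsExactlySelfSimilar`).** Crux hypotheses verbatim, `0 < ρ ≤ ½`, `u(τ) = selfSimilarCollapse γ 0 V τ`, `p(τ) = selfSimilarCollapsePressure γ 0 P τ`
for `τ < 0` ⇒ `∫_{B_L ∩ {|ℋ−m| ≤ δ}} ‖W‖² ≤ C δ L³` for all `L ≥ L₁`, `m`, `δ > 0`. [folklore] -/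
theorem setIntegral_band_norm_transport_sq_le_of_selfSimilar {ρ : ℝ} (hρ : 0 < ρ) (hρh : ρ ≤ 1 / 2)
    {u : ℝ → EuclideanSpace ℝ (Fin 3) → EuclideanSpace ℝ (Fin 3)} {p : ℝ → EuclideanSpace ℝ (Fin 3) → ℝ}
    {H : ℝ → EuclideanSpace ℝ (Fin 3) → EuclideanSpace ℝ (Fin 3) →L[ℝ] EuclideanSpace ℝ (Fin 3)} {c : ℝ≥0}
    (hsw : IsSuitableWeakSolutionOn (slab (EuclideanSpace ℝ (Fin 3)) (Iio 0) isOpen_Iio) 0 0 u p)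
    (hH : HasWeakSpatialGradientOn (slab (EuclideanSpace ℝ (Fin 3)) (Iio 0) isOpen_Iio) u H)
    (hgauge : ∀ a : ℝ, 0 < a →
      ENNReal.ofReal (a ^ (2 * ρ)) * cknA a (0 : ℝ × EuclideanSpace ℝ (Fin 3)) u +
          ENNReal.ofReal (a ^ ρ) * cknE a (0 : ℝ × EuclideanSpace ℝ (Fin 3)) H +
        ENNReal.ofReal (a ^ (2 * ρ)) * cknD a (0 : ℝ × EuclideanSpace ℝ (Fin 3)) p ≤ (c : ℝ≥0∞))
    {V : EuclideanSpace ℝ (Fin 3) → EuclideanSpace ℝ (Fin 3)} {P : EuclideanSpace ℝ (Fin 3) → ℝ}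
    (hu : ∀ τ : ℝ, τ < 0 → u τ = selfSimilarCollapse (1 / (2 + ρ)) 0 V τ)
    (hp : ∀ τ : ℝ, τ < 0 → p τ = selfSimilarCollapsePressure (1 / (2 + ρ)) 0 P τ) :
    ∃ C L₁ : ℝ, 0 ≤ C ∧ ∀ L : ℝ, L₁ ≤ L → ∀ m δ : ℝ, 0 < δ →
      ∫ x in ball (0 : EuclideanSpace ℝ (Fin 3)) L ∩ {x | |selfSimilarBernoulli (1 / (2 + ρ)) 0 V P x - m| ≤ δ},
          ‖selfSimilarTransport (1 / (2 + ρ)) 0 V x‖ ^ 2 ≤ C * δ * L ^ 3 := by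
  have hu' : ∀ τ : ℝ, τ < 0 → u τ = fun x => selfSimilarCollapse (1 / (2 + ρ)) 0 V τ (x - 0) :=
    fun τ hτ => by rw [hu τ hτ]; funext x; rw [sub_zero]
  have hp' : ∀ τ : ℝ, τ < 0 → p τ = fun x => selfSimilarCollapsePressure (1 / (2 + ρ)) 0 P τ (x - 0) :=
    fun τ hτ => by rw [hp τ hτ]; funext x; rw [sub_zero]
  exact setIntegral_band_norm_transport_sq_le_of_past hρ hρh le_rfl le_rfl 0 hsw hH hgauge hu' hp'

/-- **«NO BERNOULLI PLATEAUS» FOR A PAST-EXACT SELF-SIMILAR CLASS MEMBER** (`0 < ρ ≤ ½`; NO regularity of the profile): crux hypotheses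
verbatim, exact self-similarity about `(T, x₀)` for `τ < T₁` ⇒ for every level `m`, `vol({ℋ = m} ∩ {W ≠ 0}) = 0`. [folklore] -/
theorem volume_level_inter_eq_zero_of_past {ρ : ℝ} (hρ : 0 < ρ) (hρh : ρ ≤ 1 / 2)
    {T T₁ : ℝ} (hT₁ : T₁ ≤ 0) (hTT₁ : T₁ ≤ T) (x₀ : EuclideanSpace ℝ (Fin 3))
    {u : ℝ → EuclideanSpace ℝ (Fin 3) → EuclideanSpace ℝ (Fin 3)} {p : ℝ → EuclideanSpace ℝ (Fin 3) → ℝ}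
    {H : ℝ → EuclideanSpace ℝ (Fin 3) → EuclideanSpace ℝ (Fin 3) →L[ℝ] EuclideanSpace ℝ (Fin 3)} {c : ℝ≥0}
    (hsw : IsSuitableWeakSolutionOn (slab (EuclideanSpace ℝ (Fin 3)) (Iio 0) isOpen_Iio) 0 0 u p)
    (hH : HasWeakSpatialGradientOn (slab (EuclideanSpace ℝ (Fin 3)) (Iio 0) isOpen_Iio) u H)
    (hgauge : ∀ a : ℝ, 0 < a →
      ENNReal.ofReal (a ^ (2 * ρ)) * cknA a (0 : ℝ × EuclideanSpace ℝ (Fin 3)) u +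
          ENNReal.ofReal (a ^ ρ) * cknE a (0 : ℝ × EuclideanSpace ℝ (Fin 3)) H +
        ENNReal.ofReal (a ^ (2 * ρ)) * cknD a (0 : ℝ × EuclideanSpace ℝ (Fin 3)) p ≤ (c : ℝ≥0∞))
    {V : EuclideanSpace ℝ (Fin 3) → EuclideanSpace ℝ (Fin 3)} {P : EuclideanSpace ℝ (Fin 3) → ℝ}
    (hu : ∀ τ : ℝ, τ < T₁ → u τ = fun x => selfSimilarCollapse (1 / (2 + ρ)) T V τ (x - x₀))
    (hp : ∀ τ : ℝ, τ < T₁ → p τ = fun x => selfSimilarCollapsePressure (1 / (2 + ρ)) T P τ (x - x₀)) (m : ℝ) :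
    volume ({x | selfSimilarBernoulli (1 / (2 + ρ)) 0 V P x = m} ∩
      {x | selfSimilarTransport (1 / (2 + ρ)) 0 V x ≠ 0}) = 0 := by
  have hγ0 : 0 ≤ 1 / (2 + ρ) := by positivity
  have hγ : 1 / (2 + ρ) < 1 / 2 := by
    rw [div_lt_div_iff₀ (by linarith) (by norm_num)]; linarith
  obtain ⟨G, hV6, hG2, hP32, hdiv, hHb, cA, hcA, hA⟩ := renormalizationData_of_past hρ hρh hT₁ hTT₁ x₀ hsw hH hgauge hu hp
  exact volume_level_inter_eq_zero hγ0 hγ hV6 hG2 hP32 hdiv hHb hcA hA m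

/-- **«NO BERNOULLI PLATEAUS OFF THE STAGNATION SET» FOR AN EXACTLY SELF-SIMILAR CLASS MEMBER (origin-centred; binder shape of the
skeleton's `IsExactlySelfSimilar`).**  Crux hypotheses verbatim, `0 < ρ ≤ ½`, `u(τ) = selfSimilarCollapse γ 0 V τ`,
`p(τ) = selfSimilarCollapsePressure γ 0 P τ` for `τ < 0`: for every level `m`, `vol({ℋ = m} ∩ {W ≠ 0}) = 0` — the Bernoulli function of
the genuinely weak self-similar member (stratum `stub_selfSimilarWeakRest`) has Lebesgue-null level sets away from the similarity-stagnation
set, with no `C²` hypothesis. [folklore] -/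
theorem volume_level_inter_eq_zero_of_selfSimilar {ρ : ℝ} (hρ : 0 < ρ) (hρh : ρ ≤ 1 / 2)
    {u : ℝ → EuclideanSpace ℝ (Fin 3) → EuclideanSpace ℝ (Fin 3)} {p : ℝ → EuclideanSpace ℝ (Fin 3) → ℝ}
    {H : ℝ → EuclideanSpace ℝ (Fin 3) → EuclideanSpace ℝ (Fin 3) →L[ℝ] EuclideanSpace ℝ (Fin 3)} {c : ℝ≥0}
    (hsw : IsSuitableWeakSolutionOn (slab (EuclideanSpace ℝ (Fin 3)) (Iio 0) isOpen_Iio) 0 0 u p)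
    (hH : HasWeakSpatialGradientOn (slab (EuclideanSpace ℝ (Fin 3)) (Iio 0) isOpen_Iio) u H)
    (hgauge : ∀ a : ℝ, 0 < a →
      ENNReal.ofReal (a ^ (2 * ρ)) * cknA a (0 : ℝ × EuclideanSpace ℝ (Fin 3)) u +
          ENNReal.ofReal (a ^ ρ) * cknE a (0 : ℝ × EuclideanSpace ℝ (Fin 3)) H +
        ENNReal.ofReal (a ^ (2 * ρ)) * cknD a (0 : ℝ × EuclideanSpace ℝ (Fin 3)) p ≤ (c : ℝ≥0∞))
    {V : EuclideanSpace ℝ (Fin 3) → EuclideanSpace ℝ (Fin 3)} {P : EuclideanSpace ℝ (Fin 3) → ℝ}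
    (hu : ∀ τ : ℝ, τ < 0 → u τ = selfSimilarCollapse (1 / (2 + ρ)) 0 V τ)
    (hp : ∀ τ : ℝ, τ < 0 → p τ = selfSimilarCollapsePressure (1 / (2 + ρ)) 0 P τ) (m : ℝ) :
    volume ({x | selfSimilarBernoulli (1 / (2 + ρ)) 0 V P x = m} ∩
      {x | selfSimilarTransport (1 / (2 + ρ)) 0 V x ≠ 0}) = 0 := by
  have hu' : ∀ τ : ℝ, τ < 0 → u τ = fun x => selfSimilarCollapse (1 / (2 + ρ)) 0 V τ (x - 0) :=
    fun τ hτ => by rw [hu τ hτ]; funext x; rw [sub_zero]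
  have hp' : ∀ τ : ℝ, τ < 0 → p τ = fun x => selfSimilarCollapsePressure (1 / (2 + ρ)) 0 P τ (x - 0) :=
    fun τ hτ => by rw [hp τ hτ]; funext x; rw [sub_zero]
  exact volume_level_inter_eq_zero_of_past hρ hρh le_rfl le_rfl 0 hsw hH hgauge hu' hp' m

end Member

end WeakRenormalized

end Summit.NavierStokesRegularity.NavierStokesRegularity.Theorems.PowerGaugeEulerLiouville
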